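import Literature.Probability.Percolation.IsoradialCriticalityProofs
import Literature.Probability.Percolation.IsoradialBoxCrossingGM
import HarnessLib

/-!
# Criticality of isoradial bond percolation: the base case `ℤ²`, proved

Topic `Literature/Probability/Percolation`; theorems only (no `sorry`, no named fact).
Companion of `IsoradialCriticalityProofs` (the reduction "box-crossing property ⇒ `θ = 0`" of
Grimmett–Manolescu, PTRF 159 (2014) = arXiv:1204.0505v2, §3 Theorem 4 (Criticality) (b) from
Theorem 3) and of `IsoradialBoxCrossingGM` (the base case of Theorem 3: the canonical measure of
the isoradial square lattice `√2 ℤ²` is `P_{1/2}` and has the box-crossing property by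
Russo–Seymour–Welsh). Chaining the two gives Theorem 4 (b) **outright** in the base case of the
printed proof, the square lattice (`ℤ² ∈ 𝒢`, §4.3.1):

* `isoradialPercolation_squareLattice_percolatesAt` — under the canonical measure of `√2 ℤ²`
  every vertex lies in an infinite open cluster with probability `0`;
* `gm_theta_critical_eq_zero_squareLattice` — the named fact `gm_theta_critical_eq_zero` of
  `Isoradial` (whose square-grid hypothesis is the H21 rendering, see the verdict section of
  `IsoradialCriticalityProofs`) holds for the square lattice, for every `ε`; and
  `gm_theta_critical_eq_zero_squareLattice_printed` — its faithful form (printed square-grid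
  property `HasSquareGridPropertyGM`) at `ℤ²`, with every hypothesis of the class `𝒢`
  discharged rather than assumed (`ℤ² ∈ 𝒢(π/4, 1)`);
* `theta_squareLattice_half_eq_zero` — read through `isoradialPercolation_square_eq_holds`
  (`P_{ℤ²} = P_{1/2}`) this is `θ_x(1/2) = 0` on `ℤ²` for every vertex `x`, i.e. Harris' theorem
  (Harris 1960; tree fact `harris_theta_half` = the case `x = 0`, already discharged in
  `HarrisTheorem` by the Bollobás–Riordan dual-circuit argument, `harris_theta_half_holds`; not
  re-discharged here) re-derived along Grimmett–Manolescu's route: RSW ⇒ two-sided box-crossing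
  bounds ⇒ no crossing of `Λ_{4r} ∖ Λ_{r-2}` with probability `≥ c⁴` ⇒ independence over
  disjoint annuli; this derivation uses no planar duality.

Kept in a separate file so that `IsoradialCriticalityProofs` (imported by the arm-comparability
files) does not acquire the RSW imports of `IsoradialProofs`.

## References

* G. R. Grimmett, I. Manolescu, *Bond percolation on isoradial graphs: criticality and
  universality*, PTRF 159 (2014) 273–327 = arXiv:1204.0505v2: §2.3 (after Def. 2.2: RSW gives
  the box-crossing property of `ℤ²` at `p = 1/2`), §3 Theorem 4 (Criticality) (b) and its proof
  from Theorem 3 (end of §3), §4.3.1 (`ℤ² ∈ 𝒢`).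
* T. E. Harris, *A lower bound for the critical probability in a certain percolation process*,
  Proc. Cambridge Philos. Soc. 56 (1960) 13–20 (`θ(1/2) = 0`).
-/

noncomputable section

open MeasureTheory ProbabilityTheory

namespace Literature.Probability.Percolation

open LatticeModels Percolation

/-- **Theorem 4 (b) for the isoradial square lattice, proved**: under the canonical bond
percolation measure of `√2 ℤ²` every vertex `x` lies in an infinite open cluster with
probability `0`. Proof: `ℤ²` is preconnected, isoradially and rhombically embedded with
BAP(π/4) (`zdGraph_preconnected_holds`, `isIsoradial_squareLatticeEmbedding_holds`,
`isRhombicTiling_squareLatticeEmbedding_holds`, `hasBoundedAngles_squareLatticeEmbedding_holds`),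
its canonical measure has the box-crossing property
(`hasBoxCrossingProperty_squareLatticeEmbedding`, RSW), and the box-crossing property forces
`θ = 0` (`gm_theta_critical_eq_zero_of_hasBoxCrossingProperty`). (Grimmett–Manolescu 2014, §3
Theorem 4 (b) with §2.3 and §4.3.1; Harris 1960.)
[cite: GrimmettManolescu2014Isoradial, §3 Theorem 4 (Criticality) (b), base case ℤ² (§2.3, §4.3.1) (arXiv:1204.0505v2)] -/
theorem isoradialPercolation_squareLattice_percolatesAt (x : Site 2) :
    squareLatticeEmbedding.isoradialPercolation (percolatesAt x) = 0 :=
  gm_theta_critical_eq_zero_of_hasBoxCrossingProperty squareLatticeEmbedding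
    zdGraph_preconnected_holds isIsoradial_squareLatticeEmbedding_holds
    isRhombicTiling_squareLatticeEmbedding_holds (by positivity : (0 : ℝ) < Real.pi / 4)
    (hasBoundedAngles_squareLatticeEmbedding_holds le_rfl)
    hasBoxCrossingProperty_squareLatticeEmbedding x

/-- **The named fact `gm_theta_critical_eq_zero` holds for the square lattice** (for every `ε`,
and without using its hypotheses): immediate from
`isoradialPercolation_squareLattice_percolatesAt`; equivalently, `gm_boxCrossing_squareLattice`
fed into `gm_theta_critical_eq_zero_of_gm_boxCrossing`. So the fact — though stated for a larger
class than its source (verdict section of `IsoradialCriticalityProofs`) — is consistent with its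
proved base case. (Grimmett–Manolescu 2014, §3 Theorem 4 (b); §4.3.1: `ℤ² ∈ 𝒢`.)
[cite: GrimmettManolescu2014Isoradial, §3 Theorem 4 (Criticality) (b) at ℤ² (§4.3.1) (arXiv:1204.0505v2)] -/
theorem gm_theta_critical_eq_zero_squareLattice (ε : ℝ) :
    gm_theta_critical_eq_zero (zdGraph 2) squareLatticeEmbedding ε :=
  fun _ _ _ _ _ _ x => isoradialPercolation_squareLattice_percolatesAt x

/-- **The faithful form of Theorem 4 (b) at `ℤ²`, hypotheses included and discharged**: the
square lattice is preconnected, isoradially embedded, a rhombic tiling, has BAP(π/4) and the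
*printed* square-grid property (`hasSquareGridPropertyGM_squareLattice`, SGP(1), §4.3.1) — i.e.
`ℤ² ∈ 𝒢(π/4, 1)` — and under its canonical measure no vertex percolates. Stated as the
conjunction "`ℤ² ∈ 𝒢` and `θ = 0`", the shape of the faithful body of `gm_theta_critical_eq_zero`
(conclusion of `gm_theta_critical_eq_zero.toGM`) with every hypothesis verified rather than
assumed. (Grimmett–Manolescu 2014, §3 Theorem 4 (b) with §4.3.1 and §2.3.)
[cite: GrimmettManolescu2014Isoradial, §3 Theorem 4 (Criticality) (b); §4.3.1 (ℤ² ∈ 𝒢); §2.3 (RSW base case) (arXiv:1204.0505v2)] -/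
theorem gm_theta_critical_eq_zero_squareLattice_printed :
    ((zdGraph 2).Preconnected ∧ squareLatticeEmbedding.IsIsoradial ∧
      squareLatticeEmbedding.IsRhombicTiling ∧ (0 : ℝ) < Real.pi / 4 ∧
      squareLatticeEmbedding.HasBoundedAngles (Real.pi / 4) ∧
      squareLatticeEmbedding.HasSquareGridPropertyGM) ∧
    ∀ x : Site 2, squareLatticeEmbedding.isoradialPercolation (percolatesAt x) = 0 :=
  ⟨⟨zdGraph_preconnected_holds, isIsoradial_squareLatticeEmbedding_holds,
    isRhombicTiling_squareLatticeEmbedding_holds, by positivity,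
    hasBoundedAngles_squareLatticeEmbedding_holds le_rfl, hasSquareGridPropertyGM_squareLattice⟩,
    isoradialPercolation_squareLattice_percolatesAt⟩

/-- **`θ_x(1/2) = 0` on `ℤ²` for every vertex `x`, along Grimmett–Manolescu's route.** The
canonical measure of `√2 ℤ²` is `P_{1/2}` (`isoradialPercolation_square_eq_holds`), so
`isoradialPercolation_squareLattice_percolatesAt` reads `P_{1/2}(x ↔ ∞) = 0`, i.e.
`theta (zdGraph 2) x half = 0`; at `x = 0` this is the statement of the tree fact `harris_theta_half`
(discharged in `HarrisTheorem` as `harris_theta_half_holds`, by dual circuits; here without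
planar duality). (Harris 1960; Grimmett–Manolescu 2014, §3 Theorem 4 (b) at `ℤ²`.)
[cite: GrimmettManolescu2014Isoradial, §3 Theorem 4 (Criticality) (b) at ℤ², P_{ℤ²} = P_{1/2} (§1 after (1.3)) (arXiv:1204.0505v2)] -/
theorem theta_squareLattice_half_eq_zero (x : Site 2) : theta (zdGraph 2) x half = 0 := by
  have h := isoradialPercolation_squareLattice_percolatesAt x
  have hP : squareLatticeEmbedding.isoradialPercolation = bondPercolation (zdGraph 2) half :=
    isoradialPercolation_square_eq_holds
  rw [hP] at h
  simp only [theta, measureReal_def, h, ENNReal.toReal_zero]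

end Literature.Probability.Percolation
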